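import Mathlib.RingTheory.Ideal.Quotient.Defs
import Mathlib.Data.ZMod.QuotientRing
import Literature.Algebra.EuclideanDomain.TransfiniteSmallestAlgorithmSuperadditive
import HarnessLib

/-!
# With finite residue rings the smallest algorithm is finite valued (Samuel 1971, Proposition 15)

Topic `Literature/Algebra/EuclideanDomain`, namespace `Literature.Algebra.EuclideanDomain`.  THEOREMS ONLY (no `def`, no
instance, no named fact), all proved, in the vocabulary of `TransfiniteSmallestAlgorithm.lean` (`samuelSet R α = A_α`,
Samuel's transfinite construction; `samuelRank x = θ(x)`, the smallest algorithm) and `MotzkinConstruction.lean`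
(`motzkinSet`, `motzkinRank` — the finitely valued theory).

## Source (read at the page)

P. Samuel, *About Euclidean rings*, J. Algebra **19** (1971) 282–301 [Samuel1971] (materialised
`paper:doi-10-1016-0021-8693-71-90110-4`, §5 p. 294), VERBATIM: «We mentioned, in the introduction, the following
problem: Are transfinite valued algorithms really needed for Euclidean domains?  Since extremely nice Euclidean rings
admit transfinite valued algorithms …, the problem should be stated as: given a Euclidean domain, is its smallest
algorithm finite valued?  I do not know the answer in general.  However, **Proposition 15.** In a Euclidean domain `A`
with finite residue fields, the smallest algorithm `θ` is finite valued.  Proof.  Otherwise there is an element `b ∈ A`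
such that `θ(b) = ω`.  Every coset `cᵢ + Ab` admits a representative `rᵢ` with `θ(rᵢ) < ω`, i.e. `θ(rᵢ) = nᵢ` finite.  By
the hypothesis `A/Ab` is finite, thus `n = 1 + supᵢ(nᵢ)` is an ordinary integer.  By definition of the smallest
algorithm, we thus have `θ(b) ≤ n`, a contradiction.»  (§5 p. 291: «Let `A` be a noetherian one-dimensional domain …
for which all the residue fields are finite.  Then, if `𝔟` is a nonzero ideal of `A`, it is well known that `A/𝔟` is a
finite ring.»)

## What is formalised

The hypothesis is used, as in the printed proof, in the form «`A/Ab` is finite for `b ≠ 0`»: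
`∀ b ≠ 0, Finite (R ⧸ Ideal.span {b})` (no domain hypothesis is needed for the argument).
* `exists_mem_samuelSet_natCast_of_mem_samuelSet_omega0` — the heart: if `A/Ab` is finite and `b ∈ A_ω` then
  `b ∈ A_n` for an ordinary integer `n` («`n = 1 + supᵢ(nᵢ)`», a `Finset.sup` over the finite quotient).
* **Proposition 15** `samuelRank_lt_omega0_of_finite_quotients`: `θ(x) < ω` for every `x ∈ A′` (the element `b` with
  `θ(b) = ω` of the printed proof comes from `exists_samuelRank_eq_of_lt`: the values of `θ` form an initial segment).
* Consequences for a ring exhausted by its construction (Samuel's «Euclidean»): the finite stages already exhaust it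
  (`iUnion_samuelSet_natCast_eq_univ_of_finite_quotients`), Motzkin's criterion holds, an ordinary `ℕ`-valued algorithm
  exists (`exists_euclideanFunction_of_finite_quotients`), and `θ = motzkinRank` (`samuelRank_eq_motzkinRank_of_finite_
  quotients`).  `ℤ` satisfies the hypothesis (`Int.finite_quotient_span_singleton`, via `Int.quotientSpanEquivZMod`).

## Mathlib / tree search

Mathlib: `Ideal.Quotient.mk_surjective`, `Ideal.Quotient.eq`, `Ideal.mem_span_singleton`, `Finset.sup`/`le_sup`,
`Int.quotientSpanEquivZMod`, `ZMod.fintype`.  Tree: `TransfiniteSmallestAlgorithm.lean` (`samuelSet_omega0`,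
`samuelSet_natCast`, `mem_samuelSet_add_one_iff`, `samuelRank_le_of_mem`, `mem_samuelSet_samuelRank`,
`iUnion_samuelSet_natCast_eq_univ_iff`, `exists_euclideanFunction_iff_iUnion_samuelSet_natCast`,
`samuelRank_eq_natCast_motzkinRank`), `TransfiniteSmallestAlgorithmSuperadditive.lean` (`exists_samuelRank_eq_of_lt`).
-/

namespace Literature.Algebra.EuclideanDomain

open Ordinal

universe u

variable {R : Type u} [CommRing R]

/-- The heart of Proposition 15: if `A/Ab` is finite and every class mod `b` has a representative in some finite stage
(`b ∈ A_ω`), then finitely many stages suffice — «`n = 1 + supᵢ(nᵢ)` is an ordinary integer» — and `b ∈ A_n`.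
[cite: Samuel1971, Prop. 15 (p. 294)] -/
theorem exists_mem_samuelSet_natCast_of_mem_samuelSet_omega0 {b : R} (hfin : Finite (R ⧸ Ideal.span {b}))
    (hb : b ∈ samuelSet R ω) : ∃ n : ℕ, b ∈ samuelSet R (n : Ordinal.{u}) := by
  classical
  by_cases hb0 : b = 0
  · exact ⟨0, hb0 ▸ zero_mem_samuelSet _⟩
  rw [samuelSet_omega0] at hb
  rcases hb with hb' | H
  · exact absurd hb' hb0
  -- representatives `rᵢ ∈ A_{nᵢ}` of the classes, chosen through a section of `A → A/Ab`
  choose n r hr hd using H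
  obtain ⟨out, hout⟩ : ∃ out : R ⧸ Ideal.span {b} → R, ∀ q, Ideal.Quotient.mk _ (out q) = q :=
    ⟨fun q ↦ Classical.choose (Ideal.Quotient.mk_surjective q),
      fun q ↦ Classical.choose_spec (Ideal.Quotient.mk_surjective q)⟩
  haveI : Fintype (R ⧸ Ideal.span {b}) := Fintype.ofFinite _
  set N : ℕ := Finset.univ.sup fun q ↦ n (out q) with hN
  refine ⟨N + 1, ?_⟩
  rw [Nat.cast_succ, mem_samuelSet_add_one_iff]
  refine Or.inr fun a ↦ ?_
  -- the class of `a` is the class of `out (mk a)`, whose representative `r` lies in `A_{n} ⊆ A_N`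
  set a' := out (Ideal.Quotient.mk (Ideal.span {b}) a) with ha'
  have hn : n a' ≤ N := Finset.le_sup (f := fun q ↦ n (out q)) (Finset.mem_univ _)
  refine ⟨r a', samuelSet_mono (by exact_mod_cast hn) (hr a'), ?_⟩
  have hcls : b ∣ a - a' := by
    rw [← Ideal.mem_span_singleton, ← Ideal.Quotient.eq, ha', hout]
  have := dvd_add hcls (hd a')
  rwa [sub_add_sub_cancel] at this

/-- **Proposition 15.** «In a Euclidean domain `A` with finite residue fields, the smallest algorithm `θ` is finite
valued»: if `A/Ab` is finite for every `b ≠ 0`, then `θ(x) < ω` for every `x ∈ A′` («Otherwise there is an element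
`b ∈ A` such that `θ(b) = ω`» — by `exists_samuelRank_eq_of_lt` — and the previous lemma gives `θ(b) ≤ n`).
[cite: Samuel1971, Prop. 15 (p. 294)] -/
theorem samuelRank_lt_omega0_of_finite_quotients (hfin : ∀ b : R, b ≠ 0 → Finite (R ⧸ Ideal.span {b})) {x : R}
    (hx : ∃ α : Ordinal.{u}, x ∈ samuelSet R α) : samuelRank x < ω := by
  by_contra hge
  rw [not_lt] at hge
  -- an element `b ∈ A′` with `θ(b) = ω`
  obtain ⟨b, hbA, hb⟩ : ∃ b : R, (∃ β : Ordinal.{u}, b ∈ samuelSet R β) ∧ samuelRank b = ω := by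
    rcases hge.eq_or_lt with heq | hlt
    · exact ⟨x, hx, heq.symm⟩
    · exact exists_samuelRank_eq_of_lt hx hlt
  have hb0 : b ≠ 0 := by
    rintro rfl
    rw [samuelRank_zero] at hb
    exact omega0_ne_zero hb.symm
  have hbω : b ∈ samuelSet R ω := hb ▸ mem_samuelSet_samuelRank hbA
  obtain ⟨n, hn⟩ := exists_mem_samuelSet_natCast_of_mem_samuelSet_omega0 (hfin b hb0) hbω
  have := samuelRank_le_of_mem hn
  rw [hb] at this
  exact absurd this (not_le.2 (natCast_lt_omega0 n))

/-- For a ring exhausted by its transfinite construction with finite quotients `A/Ab` (`b ≠ 0`): every `θ(x)` is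
finite. [cite: Samuel1971, Prop. 15 (p. 294)] -/
theorem forall_samuelRank_lt_omega0_of_finite_quotients (hfin : ∀ b : R, b ≠ 0 → Finite (R ⧸ Ideal.span {b}))
    (h : ∀ x : R, ∃ α : Ordinal.{u}, x ∈ samuelSet R α) (x : R) : samuelRank x < ω :=
  samuelRank_lt_omega0_of_finite_quotients hfin (h x)

/-- Hence the FINITE stages already exhaust such a ring: `⋃_n A_n = R`. [cite: Samuel1971, Prop. 15 (p. 294)] -/
theorem iUnion_samuelSet_natCast_eq_univ_of_finite_quotients
    (hfin : ∀ b : R, b ≠ 0 → Finite (R ⧸ Ideal.span {b})) (h : ∀ x : R, ∃ α : Ordinal.{u}, x ∈ samuelSet R α) :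
    (⋃ n : ℕ, samuelSet R n) = Set.univ := by
  refine Set.eq_univ_of_forall fun x ↦ Set.mem_iUnion.2 ?_
  obtain ⟨n, hn⟩ := lt_omega0.1 (forall_samuelRank_lt_omega0_of_finite_quotients hfin h x)
  exact ⟨n, hn ▸ mem_samuelSet_samuelRank (h x)⟩

/-- … i.e. Motzkin's criterion holds. [cite: Samuel1971, Prop. 15 (p. 294); Motzkin1949, §1 (p. 1143)] -/
theorem forall_exists_not_mem_motzkinSet_of_finite_quotients
    (hfin : ∀ b : R, b ≠ 0 → Finite (R ⧸ Ideal.span {b})) (h : ∀ x : R, ∃ α : Ordinal.{u}, x ∈ samuelSet R α) :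
    ∀ b : R, ∃ k : ℕ, b ∉ (motzkinSet k : Set R) :=
  iUnion_samuelSet_natCast_eq_univ_iff.1 (iUnion_samuelSet_natCast_eq_univ_of_finite_quotients hfin h)

/-- … and an ordinary, `ℕ`-valued, Euclidean algorithm exists (Motzkin's form): transfinite valued algorithms are not
needed for rings with finite residue rings. [cite: Samuel1971, Prop. 15 (p. 294)] -/
theorem exists_euclideanFunction_of_finite_quotients
    (hfin : ∀ b : R, b ≠ 0 → Finite (R ⧸ Ideal.span {b})) (h : ∀ x : R, ∃ α : Ordinal.{u}, x ∈ samuelSet R α) :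
    ∃ φ : R → ℕ, ∀ a b : R, b ≠ 0 → ∃ q s : R, a = b * q + s ∧ (s = 0 ∨ φ s < φ b) :=
  exists_euclideanFunction_iff_iUnion_samuelSet_natCast.2 (iUnion_samuelSet_natCast_eq_univ_of_finite_quotients hfin h)

/-- … with the smallest algorithm equal to Motzkin's finitely valued one: `θ = motzkinRank`.
[cite: Samuel1971, Prop. 15 (p. 294)] -/
theorem samuelRank_eq_motzkinRank_of_finite_quotients
    (hfin : ∀ b : R, b ≠ 0 → Finite (R ⧸ Ideal.span {b})) (h : ∀ x : R, ∃ α : Ordinal.{u}, x ∈ samuelSet R α)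
    (x : R) :
    samuelRank x = (motzkinRank (forall_exists_not_mem_motzkinSet_of_finite_quotients hfin h) x : Ordinal.{u}) :=
  samuelRank_eq_natCast_motzkinRank _ x

/-- The same, starting from an arbitrary (transfinite) algorithm with values in any well-founded order: with finite
quotients `A/Ab` it can be replaced by an `ℕ`-valued one. [cite: Samuel1971, Prop. 15 (p. 294)] -/
theorem exists_euclideanFunction_of_algorithm_of_finite_quotients {T : Type*} [LT T] [WellFoundedLT T] (φ : R → T)
    (hφ : ∀ a b : R, b ≠ 0 → ∃ q r : R, a = b * q + r ∧ φ r < φ b)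
    (hfin : ∀ b : R, b ≠ 0 → Finite (R ⧸ Ideal.span {b})) :
    ∃ ψ : R → ℕ, ∀ a b : R, b ≠ 0 → ∃ q s : R, a = b * q + s ∧ (s = 0 ∨ ψ s < ψ b) :=
  exists_euclideanFunction_of_finite_quotients hfin (exists_mem_samuelSet_of_algorithm φ hφ)

/-- `ℤ` has finite residue rings `ℤ/bℤ` (`b ≠ 0`). [cite: Samuel1971, §5 (p. 291)] -/
theorem Int.finite_quotient_span_singleton (b : ℤ) (hb : b ≠ 0) : Finite (ℤ ⧸ Ideal.span {b}) := by
  haveI : NeZero b.natAbs := ⟨Int.natAbs_ne_zero.2 hb⟩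
  exact Finite.of_equiv _ (Int.quotientSpanEquivZMod b).symm.toEquiv

/-- So Proposition 15 applies to `ℤ`: its smallest algorithm is finite valued (indeed `θ(n)` = number of binary digits,
`Int.samuelRank_eq`). [cite: Samuel1971, Prop. 15 (p. 294)] -/
theorem Int.samuelRank_lt_omega0 (x : ℤ) : samuelRank x < ω :=
  forall_samuelRank_lt_omega0_of_finite_quotients Int.finite_quotient_span_singleton
    (fun x ↦ ⟨_, Int.samuelSet_omega0.symm ▸ Set.mem_univ x⟩) x

end Literature.Algebra.EuclideanDomain
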